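import Summits.RiemannHypothesis.RiemannHypothesis.Theorems.Splittings.NbCoefficientSignReal
import HarnessLib

/-!
# RH-EQUIVALENT·SPLITTING CENSUS (nb, neg) · V36 part B «MÖBIUS LOCK»: under a sup-norm budget the first coefficients of Nyman–Beurling approximants are locked to `μ(1) = 1` and `μ(2) = -1`, effectively and without any zero of `ζ`; the conjuncts «`a_0` off 1», «`a_1` off `-1`», «wrong sign `Re a_1 ≥ 0`» are refuted for every budget; nothing here bears on the truth of RH

LABEL (line 1): RH-EQUIVALENT·SPLITTING (cell `rh-split`, seat (nb, neg), generation 11, census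
candidate V36, part B).  Continuation of `Splittings.NbCoefficientSign` (part A: half-plane law,
two-signs laws, real approximants, the dichotomy HALF-PLANE(u) ⟺ (Re u = 0 ∧ RH)).  Object: the
PROFILE of the coefficient vector `a` of `A(s) = Σ_{n<N} a_n (n+1)^{-s}` in the route's integral
`I(N,a) = ∫ |1 - ζA|²(1/2+it) dt/(1/4+t²)` (`Theses.NymanBeurling.NbThesis`, verbatim integrand)
under a SUP-NORM BUDGET `‖a_n‖ ≤ M ∀ n`.  Zero definitions; standard axioms; NO zero of `ζ` is used.

## Results (evaluation points `k ∈ ℕ`, `k ≥ 4`; `K(x) = x²(x+1)²/((x-1/2)(x-1))`)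

* `nbImBalance_law`: for ANY coefficients with `I(N,a) ≤ i`, `|Σ_n Im(a_n)(n+1)^{-2}| ≤ (6/π²)·24√i`
  (the companion of part A's two-signs laws at `u = I`).
* `zeta_nat_eq_one_add_tail`, `zeta_nat_eq_one_add_add_tail`: `ζ(k) = 1 + τ`, `0 ≤ τ ≤ (π⁴/90-1)2^{4-k}`,
  and `ζ(k) = 1 + 2^{-k} + τ'`, `0 ≤ τ' ≤ (π⁴/90-17/16)3^{4-k}` (from `hasSum_zeta_four`).
* LOCK-0 `norm_constCoeff_sub_one_le`: `‖a_0 - 1‖ ≤ √i·K(k) + M·2^{4-k}/5`.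
* LOCK-1 `norm_constCoeff_add_secondCoeff_le`: `‖a_0 + a_1‖ ≤ 2^k√i(K(k)+K(2k)) + 10M(2/3)^k`.
  Hence along any budgeted sequence with `I → 0`: `a_0 → 1 = μ(1)` and `a_1 → -1 = μ(2)`, with
  explicit rates (choosing `2^k ≍ M/√I` in LOCK-0: `‖a_0 - 1‖ ≪ √I·log²(2 + M/√I)`).
* REFUTED CONJUNCTS (every budget `M`, every `δ > 0`): `not_nbConstCoeffBddApprox`
  («`‖a_0 - 1‖ ≥ δ`»), `not_nbSecondCoeffBddApprox` («`‖a_1 + 1‖ ≥ δ`»), `not_nbPosReSecondCoeffBddApprox`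
  («`Re a_1 ≥ 0`», the wrong sign at `n = 2`).  Each conjunct trivially implies `NbThesis`, so as a
  splitting conjunct it was RH-PLUS; here it is false outright.

## The argument

At a natural point `k ≥ 4`, `A(k) = a_0 + a_1 2^{-k} + T` with `|T| ≤ M(ζ(k) - 1 - 2^{-k}) ≤ M·81·3^{-k}·0.0315`
and `ζ(k) = 1 + 2^{-k} + τ'`; part A's zero-free point bound `|1 - ζ(k)A(k)| ≤ √I·K(k)`
(`norm_one_sub_zeta_mul_dirichletPoly_le_real`, from the tree's `NbBddNatural.norm_nbG_le_of_re`)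
first pins `a_0` (LOCK-0 at `k`), then, using LOCK-0 at `2k` for the `a_0 - 1` term, pins
`a_0 + a_1` through the identity
`2^{-k}(a_0 + a_1) = -(1 - ζA) - (a_0 - 1) - (a_1 4^{-k} + τ'(a_0 + a_1 2^{-k}) + ζ(k)T)`.
WITHOUT a budget no such lock can hold pointwise (Müntz: `Σ 1/log n = ∞`, so `1` is a limit of
budget-free combinations of the other `n^{-s}` locally uniformly on `Re s > 1`) — the budget-free
lock is a Mellin/Plancherel statement on the critical line, not typed here.
Print context: Báez-Duarte, arXiv:math/0011254, Lemma 4.2 / Remark 4.7 («inevitability of the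
natural approximation»: in Beurling's space, coefficients of pointwise-convergent approximations
tend to `μ`); Landreau–Richard, Exp. Math. 11 (2002), p. 352 (`a_{n,k} → -μ(k)` numerically for the
optimal vectors; «RH implique cette propriété»).  The present statements are effective, zero-free
and on the Dirichlet-polynomial side.

FILE 1/2 of V36 part B (referee carve for the gate's ≤ 400-line rule, decl text verbatim):
§1, §2 (LOCK-0, `not_nbConstCoeffBddApprox`) and the `ζ(k)`/splitting lemmas of §3 here; LOCK-1
`norm_constCoeff_add_secondCoeff_le`, `not_nbSecondCoeffBddApprox`, `not_nbPosReSecondCoeffBddApprox`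
continue in `Splittings.NbCoefficientLockSecond` (same namespace).

HONEST LABEL: «SPLITTING SEARCH over kernel-typed RH-EQUIVALENCES; a splitting A ∧ B ⟹ RH is
CONDITIONAL bookkeeping unless A and B are both proved; nothing here bears on the truth of RH.»
-/

set_option linter.dupNamespace false

noncomputable section

open Complex MeasureTheory Filter Topology
open scoped Real ComplexConjugate

namespace Summit.RiemannHypothesis.RiemannHypothesis.Theorems.Splittings.NbCoefficientLock

open Literature.NumberTheory.LFunctions
open Summit.RiemannHypothesis.RiemannHypothesis.Theorems.Splittings.NbBddNatural
open Summit.RiemannHypothesis.RiemannHypothesis.Theorems.Splittings.NbCoefficientSign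
open Summit.RiemannHypothesis.RiemannHypothesis.Theses.NymanBeurling

/-! ## 1. The imaginary balance law (companion of part A §5) -/

/-- **IMAGINARY BALANCE LAW (V36, zero-free).** For ANY coefficients with `I(N,a) ≤ i`, the
`(n+1)^{-2}`-weighted imaginary parts nearly cancel: `|Σ_n Im(a_n)(n+1)^{-2}| ≤ (6/π²)·24√i`. -/
theorem nbImBalance_law {N : ℕ} (a : Fin N → ℂ) {i : ℝ} (hi : 0 ≤ i)
    (hI : ∫⁻ t : ℝ, ENNReal.ofReal (‖1 - riemannZeta (1 / 2 + t * Complex.I) *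
        ∑ n : Fin N, a n * ((n : ℂ) + 1) ^ (-(1 / 2 + t * Complex.I))‖ ^ 2 / (1 / 4 + t ^ 2)) ≤
      ENNReal.ofReal i) :
    |∑ n : Fin N, (a n).im * (((n : ℝ) + 1) ^ (-(2 : ℝ)))| ≤ 6 / π ^ 2 * (24 * Real.sqrt i) := by
  obtain ⟨hz2l, -, -, -⟩ := zeta_two_four_window
  have h := abs_re_sub_zeta_two_mul_le Complex.I (by simp) a hi hI
  rw [re_mul_dirichletPoly_ofReal] at h
  simp only [Complex.I_re, Complex.I_mul_re, neg_mul, Finset.sum_neg_distrib, mul_neg, zero_sub,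
    abs_neg] at h
  have hz : 0 < π ^ 2 / 6 := by linarith
  rw [abs_mul, abs_of_pos hz] at h
  rw [show 6 / π ^ 2 = (π ^ 2 / 6)⁻¹ by field_simp, ← div_eq_inv_mul, le_div_iff₀ hz, mul_comm]
  exact h

/-! ## 2. Effective lock of the constant coefficient under a sup-norm budget (zero-free) -/

/-- The real series `Σ_{n ≥ 0} 1/(n+2)⁴ = π⁴/90 - 1`. -/
theorem hasSum_one_div_add_two_pow_four :
    HasSum (fun n : ℕ ↦ 1 / ((n : ℝ) + 2) ^ 4) (π ^ 4 / 90 - 1) := by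
  have h := (hasSum_nat_add_iff' 2).mpr hasSum_zeta_four
  have hrange : ∑ i ∈ Finset.range 2, 1 / ((i : ℕ) : ℝ) ^ 4 = 1 := by
    simp [Finset.sum_range_succ]
  rw [hrange] at h
  have e : (fun n : ℕ ↦ 1 / (((n + 2 : ℕ) : ℝ)) ^ 4) = fun n : ℕ ↦ 1 / ((n : ℝ) + 2) ^ 4 := by
    funext n; simp only [Nat.cast_add, Nat.cast_ofNat]
  rw [e] at h
  exact h

/-- **Real tail of `ζ` at natural points `k ≥ 4`:** `ζ(k) = 1 + τ_k` with
`τ_k = Σ_{n≥0} (n+2)^{-k}` and `0 ≤ τ_k ≤ (π⁴/90 - 1)·2^{4-k}`. -/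
theorem zeta_nat_eq_one_add_tail {k : ℕ} (hk : 4 ≤ k) :
    ∃ τ : ℝ, riemannZeta k = 1 + (τ : ℂ) ∧ 0 ≤ τ ∧ τ ≤ (π ^ 4 / 90 - 1) * (1 / 2) ^ (k - 4) ∧
      HasSum (fun n : ℕ ↦ 1 / ((n : ℝ) + 2) ^ k) τ := by
  have hk1 : 1 < k := by omega
  obtain ⟨S, hS⟩ := Real.summable_one_div_nat_pow.mpr hk1
  have hτ := (hasSum_nat_add_iff' 2).mpr hS
  have hrange : ∑ i ∈ Finset.range 2, 1 / ((i : ℕ) : ℝ) ^ k = 1 := by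
    simp [Finset.sum_range_succ, zero_pow (by omega : k ≠ 0)]
  rw [hrange] at hτ
  have hτ' : HasSum (fun n : ℕ ↦ 1 / ((n : ℝ) + 2) ^ k) (S - 1) := by
    have e : (fun n : ℕ ↦ 1 / (((n + 2 : ℕ) : ℝ)) ^ k) = fun n : ℕ ↦ 1 / ((n : ℝ) + 2) ^ k := by
      funext n; simp only [Nat.cast_add, Nat.cast_ofNat]
    rw [e] at hτ
    exact hτ
  refine ⟨S - 1, ?_, hτ'.nonneg fun n ↦ by positivity, ?_, hτ'⟩
  · rw [zeta_nat_eq_tsum_of_gt_one hk1]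
    have hC : HasSum (fun n : ℕ ↦ 1 / (n : ℂ) ^ k) (S : ℂ) := by
      have h := (Complex.hasSum_ofReal (f := fun n : ℕ ↦ 1 / (n : ℝ) ^ k) (x := S)).mpr hS
      have e : (fun n : ℕ ↦ ((1 / (n : ℝ) ^ k : ℝ) : ℂ)) = fun n : ℕ ↦ 1 / (n : ℂ) ^ k := by
        funext n; push_cast; rfl
      rw [e] at h
      exact h
    rw [hC.tsum_eq]
    push_cast
    ring
  · have hcmp : ∀ n : ℕ, 1 / ((n : ℝ) + 2) ^ k ≤ (1 / 2) ^ (k - 4) * (1 / ((n : ℝ) + 2) ^ 4) := by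
      intro n
      have hn2 : (2 : ℝ) ≤ (n : ℝ) + 2 := by
        have : (0 : ℝ) ≤ n := Nat.cast_nonneg n
        linarith
      have hpow : (2 : ℝ) ^ (k - 4) ≤ ((n : ℝ) + 2) ^ (k - 4) := pow_le_pow_left₀ (by norm_num) hn2 _
      have hsplit : ((n : ℝ) + 2) ^ k = ((n : ℝ) + 2) ^ 4 * ((n : ℝ) + 2) ^ (k - 4) := by
        rw [← pow_add]; congr 1; omega
      calc 1 / ((n : ℝ) + 2) ^ k = 1 / (((n : ℝ) + 2) ^ 4 * ((n : ℝ) + 2) ^ (k - 4)) := by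
            rw [hsplit]
        _ ≤ 1 / (((n : ℝ) + 2) ^ 4 * 2 ^ (k - 4)) :=
            one_div_le_one_div_of_le (by positivity) (mul_le_mul_of_nonneg_left hpow (by positivity))
        _ = (1 / 2) ^ (k - 4) * (1 / ((n : ℝ) + 2) ^ 4) := by
            rw [one_div_pow]; field_simp
    rw [mul_comm]
    exact hasSum_le hcmp hτ' (hasSum_one_div_add_two_pow_four.mul_left _)

/-- **EFFECTIVE LOCK OF THE CONSTANT COEFFICIENT (V36, zero-free).** If all coefficients satisfy
`‖a_n‖ ≤ M` and `I(N+1, a) ≤ i`, then for every natural `k ≥ 4`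
`‖a_0 - 1‖ ≤ √i · k²(k+1)²/((k-1/2)(k-1)) + M·2^{4-k}/5`:
the constant coefficient of a budgeted approximant is forced towards `μ(1) = 1`, at rate
`O(√i·log²(M/√i))` after optimising `k` (compare Báez-Duarte, arXiv:math/0011254 Lemma 4.2, where
coefficients of pointwise-convergent approximations in Beurling's space tend to `μ`). -/
theorem norm_constCoeff_sub_one_le {N : ℕ} (a : Fin (N + 1) → ℂ) {M : ℝ} (hM : ∀ n, ‖a n‖ ≤ M)
    {i : ℝ} (hi : 0 ≤ i)
    (hI : ∫⁻ t : ℝ, ENNReal.ofReal (‖1 - riemannZeta (1 / 2 + t * Complex.I) *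
        ∑ n : Fin (N + 1), a n * ((n : ℂ) + 1) ^ (-(1 / 2 + t * Complex.I))‖ ^ 2 / (1 / 4 + t ^ 2)) ≤
      ENNReal.ofReal i) {k : ℕ} (hk : 4 ≤ k) :
    ‖a 0 - 1‖ ≤ Real.sqrt i * ((k : ℝ) ^ 2 * ((k : ℝ) + 1) ^ 2 / (((k : ℝ) - 1 / 2) * ((k : ℝ) - 1))) +
      M * (1 / 2) ^ (k - 4) / 5 := by
  obtain ⟨τ, hζ, hτ0, hτle, hτsum⟩ := zeta_nat_eq_one_add_tail hk
  obtain ⟨-, -, -, hz4u⟩ := zeta_two_four_window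
  have hM0 : 0 ≤ M := (norm_nonneg _).trans (hM 0)
  have hkR : (1 : ℝ) < (k : ℝ) := by exact_mod_cast (show 1 < k by omega)
  -- the real-point bound at `x = k`
  have hpt := norm_one_sub_zeta_mul_dirichletPoly_le_real a hi hI hkR
  rw [Complex.ofReal_natCast] at hpt
  set K : ℝ := (k : ℝ) ^ 2 * ((k : ℝ) + 1) ^ 2 / (((k : ℝ) - 1 / 2) * ((k : ℝ) - 1)) with hKdef
  -- split `A(k) = a_0 + T`
  set T : ℂ := ∑ j : Fin N, a j.succ * ((((j : ℕ) : ℂ) + 2) ^ k)⁻¹ with hTdef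
  have hA : dirichletPoly a (k : ℂ) = a 0 + T := by
    rw [dirichletPoly_apply, Fin.sum_univ_succ]
    congr 1
    · simp [Complex.cpow_neg, Complex.cpow_natCast]
    · refine Finset.sum_congr rfl fun j _ ↦ ?_
      rw [Complex.cpow_neg, Complex.cpow_natCast, Fin.val_succ]
      push_cast
      ring
  -- `‖T‖ ≤ M τ`
  have hT : ‖T‖ ≤ M * τ := by
    calc ‖T‖ ≤ ∑ j : Fin N, ‖a j.succ * ((((j : ℕ) : ℂ) + 2) ^ k)⁻¹‖ := norm_sum_le _ _
      _ ≤ ∑ j : Fin N, M * (1 / (((j : ℕ) : ℝ) + 2) ^ k) := by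
          refine Finset.sum_le_sum fun j _ ↦ ?_
          have h2 : ‖(((j : ℕ) : ℂ) + 2) ^ k‖ = (((j : ℕ) : ℝ) + 2) ^ k := by
            have : (((j : ℕ) : ℂ) + 2) = ((((j : ℕ) : ℝ) + 2 : ℝ) : ℂ) := by push_cast; ring
            rw [norm_pow, this, Complex.norm_real, Real.norm_of_nonneg (by positivity)]
          rw [norm_mul, norm_inv, h2, ← one_div]
          exact mul_le_mul_of_nonneg_right (hM _) (by positivity)
      _ = M * ∑ j : Fin N, 1 / (((j : ℕ) : ℝ) + 2) ^ k := by rw [Finset.mul_sum]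
      _ ≤ M * τ := by
          refine mul_le_mul_of_nonneg_left ?_ hM0
          rw [Fin.sum_univ_eq_sum_range (fun j ↦ 1 / ((j : ℝ) + 2) ^ k) N]
          exact sum_le_hasSum _ (fun j _ ↦ by positivity) hτsum
  -- the algebraic identity `1 - a_0 = (1 - ζA) + ζ T + (ζ - 1) a_0`
  have hid : a 0 - 1 = -((1 - riemannZeta k * dirichletPoly a k) + riemannZeta k * T +
      (riemannZeta k - 1) * a 0) := by rw [hA]; ring
  have hζn : ‖riemannZeta k‖ = 1 + τ := by
    rw [hζ, show (1 : ℂ) + (τ : ℂ) = ((1 + τ : ℝ) : ℂ) by push_cast; ring, Complex.norm_real,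
      Real.norm_of_nonneg (by linarith)]
  have hζ1 : ‖riemannZeta k - 1‖ = τ := by
    rw [hζ, add_sub_cancel_left, Complex.norm_real, Real.norm_of_nonneg hτ0]
  have hmain : ‖a 0 - 1‖ ≤ Real.sqrt i * K + (1 + τ) * (M * τ) + τ * M := by
    rw [hid, norm_neg]
    calc ‖(1 - riemannZeta k * dirichletPoly a k) + riemannZeta k * T + (riemannZeta k - 1) * a 0‖
        ≤ ‖1 - riemannZeta k * dirichletPoly a k‖ + ‖riemannZeta k * T‖ +
            ‖(riemannZeta k - 1) * a 0‖ := norm_add₃_le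
      _ ≤ Real.sqrt i * K + (1 + τ) * (M * τ) + τ * M := by
          rw [norm_mul, norm_mul, hζn, hζ1]
          gcongr
          · exact hM 0
  -- numerics: `τ ≤ c r`, `c < 0.094`, `r ≤ 1`
  set r : ℝ := (1 / 2 : ℝ) ^ (k - 4) with hrdef
  have hr0 : 0 ≤ r := by positivity
  have hr1 : r ≤ 1 := pow_le_one₀ (by norm_num) (by norm_num)
  have hc : π ^ 4 / 90 - 1 ≤ 0.094 := by linarith
  have hτr : τ ≤ 0.094 * r := hτle.trans (mul_le_mul_of_nonneg_right hc hr0)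
  have hτ1 : τ ≤ 0.094 := by nlinarith
  have hMτ : 0 ≤ M * τ := mul_nonneg hM0 hτ0
  calc ‖a 0 - 1‖ ≤ Real.sqrt i * K + (1 + τ) * (M * τ) + τ * M := hmain
    _ ≤ Real.sqrt i * K + 1.094 * (M * (0.094 * r)) + 0.094 * r * M := by
        gcongr
        · linarith
    _ ≤ Real.sqrt i * K + M * r / 5 := by nlinarith [mul_nonneg hM0 hr0]

/-- **V36 conjunct «DROP-μ(1) under budget» REFUTED (zero-free, effective).** For every budget
`M` and every `δ > 0` it is NOT the case that for every `ε > 0` some Dirichlet polynomial with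
`‖a_n‖ ≤ M ∀ n` and constant coefficient at distance `≥ δ` from `μ(1) = 1` (e.g. `a_0 = 0`:
the constant term dropped) has `I < ε`.  The budget-free version is not treated (Müntz-type
density makes coefficient extraction discontinuous without a budget). -/
theorem not_nbConstCoeffBddApprox (M δ : ℝ) (hδ : 0 < δ) :
    ¬ (∀ ε : ℝ, 0 < ε → ∃ (N : ℕ) (a : Fin (N + 1) → ℂ), (∀ n, ‖a n‖ ≤ M) ∧ δ ≤ ‖a 0 - 1‖ ∧
      ∫⁻ t : ℝ, ENNReal.ofReal (‖1 - riemannZeta (1 / 2 + t * Complex.I) *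
        ∑ n : Fin (N + 1), a n * ((n : ℂ) + 1) ^ (-(1 / 2 + t * Complex.I))‖ ^ 2 / (1 / 4 + t ^ 2)) <
      ENNReal.ofReal ε) := by
  intro h
  -- choose `k = j + 4` with `2^j > 2M/δ`, so that the budget term is `< δ/2`... precisely `≤ δ/10·…`
  obtain ⟨j, hj⟩ := pow_unbounded_of_one_lt (M / δ) (by norm_num : (1 : ℝ) < 2)
  set k : ℕ := j + 4 with hkdef
  have hk : 4 ≤ k := by omega
  set K : ℝ := (k : ℝ) ^ 2 * ((k : ℝ) + 1) ^ 2 / (((k : ℝ) - 1 / 2) * ((k : ℝ) - 1)) with hKdef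
  have hk4 : (4 : ℝ) ≤ (k : ℝ) := by exact_mod_cast hk
  have hKpos : 0 < K := by
    rw [hKdef]
    apply div_pos (by positivity)
    apply mul_pos <;> linarith
  -- ε with `√ε · K = δ / 4`
  set ε : ℝ := (δ / (4 * K)) ^ 2 with hεdef
  have hε : 0 < ε := by positivity
  obtain ⟨N, a, hM, hδa, hlt⟩ := h ε hε
  have hM0 : 0 ≤ M := (norm_nonneg _).trans (hM 0)
  have hle := norm_constCoeff_sub_one_le a hM hε.le hlt.le hk
  have hsq : Real.sqrt ε = δ / (4 * K) := by
    rw [hεdef, Real.sqrt_sq (by positivity)]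
  rw [hsq] at hle
  have hKterm : δ / (4 * K) * K = δ / 4 := by field_simp
  have hr : (1 / 2 : ℝ) ^ (k - 4) = ((2 : ℝ) ^ j)⁻¹ := by
    rw [show k - 4 = j by omega, one_div, inv_pow]
  have h2j : 0 < (2 : ℝ) ^ j := by positivity
  have hbudget : M * (1 / 2 : ℝ) ^ (k - 4) / 5 < δ / 5 := by
    rw [hr, div_lt_div_iff_of_pos_right (by norm_num : (0 : ℝ) < 5)]
    rw [div_lt_iff₀ hδ] at hj
    rw [← div_eq_mul_inv, div_lt_iff₀ h2j]
    linarith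
  linarith

/-! ## 3. Effective lock of the second coefficient: `a_1 → μ(2) = -1` under a budget -/

/-- The real series `Σ_{n ≥ 0} 1/(n+3)⁴ = π⁴/90 - 1 - 1/16`. -/
theorem hasSum_one_div_add_three_pow_four :
    HasSum (fun n : ℕ ↦ 1 / ((n : ℝ) + 3) ^ 4) (π ^ 4 / 90 - 1 - 1 / 16) := by
  have h := (hasSum_nat_add_iff' 3).mpr hasSum_zeta_four
  have hrange : ∑ i ∈ Finset.range 3, 1 / ((i : ℕ) : ℝ) ^ 4 = 1 + 1 / 16 := by
    simp [Finset.sum_range_succ]; norm_num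
  rw [hrange] at h
  have e : (fun n : ℕ ↦ 1 / (((n + 3 : ℕ) : ℝ)) ^ 4) = fun n : ℕ ↦ 1 / ((n : ℝ) + 3) ^ 4 := by
    funext n; simp only [Nat.cast_add, Nat.cast_ofNat]
  rw [e, show π ^ 4 / 90 - (1 + 1 / 16) = π ^ 4 / 90 - 1 - 1 / 16 by ring] at h
  exact h

/-- **Second-order real tail of `ζ` at natural points `k ≥ 4`:** `ζ(k) = 1 + 2^{-k} + τ'_k` with
`τ'_k = Σ_{n≥0} (n+3)^{-k}` and `0 ≤ τ'_k ≤ (π⁴/90 - 17/16)·3^{4-k}`. -/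
theorem zeta_nat_eq_one_add_add_tail {k : ℕ} (hk : 4 ≤ k) :
    ∃ τ : ℝ, riemannZeta k = 1 + 1 / (2 : ℂ) ^ k + (τ : ℂ) ∧ 0 ≤ τ ∧
      τ ≤ (π ^ 4 / 90 - 1 - 1 / 16) * (1 / 3) ^ (k - 4) ∧
      HasSum (fun n : ℕ ↦ 1 / ((n : ℝ) + 3) ^ k) τ := by
  have hk1 : 1 < k := by omega
  obtain ⟨S, hS⟩ := Real.summable_one_div_nat_pow.mpr hk1
  have hτ := (hasSum_nat_add_iff' 3).mpr hS
  have hrange : ∑ i ∈ Finset.range 3, 1 / ((i : ℕ) : ℝ) ^ k = 1 + 1 / 2 ^ k := by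
    simp [Finset.sum_range_succ, zero_pow (by omega : k ≠ 0)]
  rw [hrange] at hτ
  have hτ' : HasSum (fun n : ℕ ↦ 1 / ((n : ℝ) + 3) ^ k) (S - (1 + 1 / 2 ^ k)) := by
    have e : (fun n : ℕ ↦ 1 / (((n + 3 : ℕ) : ℝ)) ^ k) = fun n : ℕ ↦ 1 / ((n : ℝ) + 3) ^ k := by
      funext n; simp only [Nat.cast_add, Nat.cast_ofNat]
    rw [e] at hτ
    exact hτ
  refine ⟨S - (1 + 1 / 2 ^ k), ?_, hτ'.nonneg fun n ↦ by positivity, ?_, hτ'⟩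
  · rw [zeta_nat_eq_tsum_of_gt_one hk1]
    have hC : HasSum (fun n : ℕ ↦ 1 / (n : ℂ) ^ k) (S : ℂ) := by
      have h := (Complex.hasSum_ofReal (f := fun n : ℕ ↦ 1 / (n : ℝ) ^ k) (x := S)).mpr hS
      have e : (fun n : ℕ ↦ ((1 / (n : ℝ) ^ k : ℝ) : ℂ)) = fun n : ℕ ↦ 1 / (n : ℂ) ^ k := by
        funext n; push_cast; rfl
      rw [e] at h
      exact h
    rw [hC.tsum_eq]
    push_cast
    ring
  · have hcmp : ∀ n : ℕ, 1 / ((n : ℝ) + 3) ^ k ≤ (1 / 3) ^ (k - 4) * (1 / ((n : ℝ) + 3) ^ 4) := by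
      intro n
      have hn3 : (3 : ℝ) ≤ (n : ℝ) + 3 := by
        have : (0 : ℝ) ≤ n := Nat.cast_nonneg n
        linarith
      have hpow : (3 : ℝ) ^ (k - 4) ≤ ((n : ℝ) + 3) ^ (k - 4) := pow_le_pow_left₀ (by norm_num) hn3 _
      have hsplit : ((n : ℝ) + 3) ^ k = ((n : ℝ) + 3) ^ 4 * ((n : ℝ) + 3) ^ (k - 4) := by
        rw [← pow_add]; congr 1; omega
      calc 1 / ((n : ℝ) + 3) ^ k = 1 / (((n : ℝ) + 3) ^ 4 * ((n : ℝ) + 3) ^ (k - 4)) := by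
            rw [hsplit]
        _ ≤ 1 / (((n : ℝ) + 3) ^ 4 * 3 ^ (k - 4)) :=
            one_div_le_one_div_of_le (by positivity) (mul_le_mul_of_nonneg_left hpow (by positivity))
        _ = (1 / 3) ^ (k - 4) * (1 / ((n : ℝ) + 3) ^ 4) := by
            rw [one_div_pow]; field_simp
    rw [mul_comm]
    exact hasSum_le hcmp hτ' (hasSum_one_div_add_three_pow_four.mul_left _)

/-- `A_a(k) = a_0 + a_1 2^{-k} + Σ_{j} a_{j+2} (j+3)^{-k}` at a natural point `k`. -/
theorem dirichletPoly_nat_split_two {N : ℕ} (a : Fin (N + 2) → ℂ) (k : ℕ) :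
    dirichletPoly a (k : ℂ) = a 0 + a 1 * ((2 : ℂ) ^ k)⁻¹ +
      ∑ j : Fin N, a j.succ.succ * ((((j : ℕ) : ℂ) + 3) ^ k)⁻¹ := by
  rw [dirichletPoly_apply, Fin.sum_univ_succ, Fin.sum_univ_succ]
  simp only [Fin.succ_zero_eq_one, Fin.val_one, Fin.val_zero, Fin.val_succ, Nat.cast_zero,
    Nat.cast_one, Nat.cast_add, Complex.cpow_neg, Complex.cpow_natCast]
  have e : ∀ j : Fin N, ((j : ℕ) : ℂ) + 1 + 1 + 1 = ((j : ℕ) : ℂ) + 3 := fun j ↦ by ring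
  simp only [e]
  norm_num
  ring

end Summit.RiemannHypothesis.RiemannHypothesis.Theorems.Splittings.NbCoefficientLock
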